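import Summits.HubbardSuperconductivity.HubbardSuperconductivity.Theorems.AnisotropyChordStiffnessCompressibility
import Mathlib.Analysis.InnerProductSpace.Basic

/-!
# Route `AnisotropyChord` / H0 rotor rung: RUNG IR2 — the k-LINEAR structure-factor bound `S(k) ≤ C·|k|_T` from
# compressibility (K) and the lattice f-sum rule (theory seat `hubbard-h0-rotor-theory-1`, cycle 9, memo ROTOR-THEORY-9
# §136 (b), (k), (l); HOME file `PartT_Moments.lean` ported)

The tree's `structureFactorUpper_of_susceptibility` (…StiffnessCompressibility) bounds `(P·S(k))² ≤ m₁(k)·m₋₁(k)` with the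
f-sum weight estimated by `1 − cos(2πk_j/L) ≤ 2`, giving a CONSTANT `S_max`.  Memo §136 (l) records the one-line refinement
that matters physically: `1 − cos(2πk_j/L) ≤ |k|_T,j²/2` (reduced wave number), so the SAME hypotheses give the k-linear
bound `S(k) ≤ (√κ⁺/ρ)·|k|_T` — the two-point signature of the `1/r` Jastrow tail (Reatto–Chester) and the input of the
Feynman–RPA identification in the H0 programme (memo §136 (k)).

* `fsumWeight_eq_reduced`, `fsumWeight_le_sq`, `sum_fsumWeight_le_torusNorm_sq` — `Σ_j (1 − cos(2πk_j/L)) ≤ |k|_T²/2`;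
* **`structureFactor_le_linear_of_susceptibility`** : `ρ_L → ρ ∈ (0,1) → LatticeFSumRule Δ → UniformSusceptibility Δ M →
  ∃ C, ∀ᶠ L, ∀` Perron amplitudes of the sectors `M_L, M_L − 1`, `∀ k ≠ 0`, `S(k) ≤ C·|k|_T` (with `C = √κ⁺/ρ`);
  **`structureFactor_le_linear_of_uniformSusceptibility`** : the same with the f-sum rule discharged by the tree theorem
  `latticeFSumRule_holds`;
* the abstract core (HOME `PartT_Moments.lean`, any real inner-product space, susceptibility defined VARIATIONALLY, no
  positivity / invertibility / finite dimension): `Moments.moment_ineq` (`‖φ‖⁴ ≤ ⟪φ,Tφ⟫·χ` whenever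
  `2⟪φ,η⟫ − ⟪η,Tη⟫ ≤ χ` for all `η`), `Moments.fsum_double_commutator(')` (the double-commutator form of `m₁` on an
  eigenvector), `Moments.structureFactor_sq_le`.
Sources: Pitaevskii–Stringari, J. Low Temp. Phys. 85 (1991) 377 (uncertainty-principle inequality at `T = 0`);
S. Stringari, «Sum rules and Bose–Einstein condensation», in Griffin–Snoke–Stringari (eds.), *Bose–Einstein Condensation*
(CUP 1995), pp. 72–76 (compressibility sum rule `∫ω⁻¹S(q,ω) = χ(q)/2`, f-sum rule).  All statements here are folklore-level;
the typing authority for the port is the theory seat.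
-/

set_option linter.dupNamespace false

noncomputable section

open Matrix Complex Finset Filter Topology
open scoped ComplexConjugate
open Literature.MathematicalPhysics.QuantumLattice hiding torusPhase torusNorm
open Literature.Probability.LatticeModels
open Summit.HubbardSuperconductivity.HubbardSuperconductivity.Theorems.AnisotropyChord.InsertionEntropy

namespace Summit.HubbardSuperconductivity.HubbardSuperconductivity.Theorems.AnisotropyChord.Stiffness

section FSumWeight

variable (L : ℕ) [NeZero L]

/-- The f-sum weight only sees the REDUCED component `m_j = min(k_j, L − k_j)`:
`1 − cos(2πk_j/L) = 1 − cos(2πm_j/L)` (`cos(2π − θ) = cos θ`). [folklore] -/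
theorem fsumWeight_eq_reduced (k : TorusSite 2 L) (j : Fin 2) :
    fsumWeight L k j = 1 - Real.cos (2 * Real.pi * ((min (k j).val (L - (k j).val) : ℕ) : ℝ) / (L : ℝ)) := by
  unfold fsumWeight
  have hL : (0 : ℝ) < (L : ℝ) := by exact_mod_cast Nat.pos_of_ne_zero (NeZero.ne L)
  have hv : (k j).val < L := ZMod.val_lt (k j)
  rcases le_total (k j).val (L - (k j).val) with h | h
  · rw [min_eq_left h]
  · rw [min_eq_right h, Nat.cast_sub hv.le]
    congr 1
    rw [show 2 * Real.pi * ((L : ℝ) - ((k j).val : ℝ)) / (L : ℝ)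
        = 2 * Real.pi - 2 * Real.pi * ((k j).val : ℝ) / (L : ℝ) by field_simp]
    rw [Real.cos_two_pi_sub]

/-- `1 − cos(2πk_j/L) ≤ (2πm_j/L)²/2` with the reduced component `m_j = min(k_j, L − k_j)`. [folklore] -/
theorem fsumWeight_le_sq (k : TorusSite 2 L) (j : Fin 2) :
    fsumWeight L k j ≤ (2 * Real.pi * ((min (k j).val (L - (k j).val) : ℕ) : ℝ) / (L : ℝ)) ^ 2 / 2 := by
  rw [fsumWeight_eq_reduced L k j]
  linarith [Real.one_sub_sq_div_two_le_cos
    (x := 2 * Real.pi * ((min (k j).val (L - (k j).val) : ℕ) : ℝ) / (L : ℝ))]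

/-- **`Σ_j (1 − cos(2πk_j/L)) ≤ |k|_T²/2`** with the tree's reduced wave number
`|k|_T = (2π/L)·‖(m_j)_j‖` (`InsertionEntropy.torusNorm`). [folklore] -/
theorem sum_fsumWeight_le_torusNorm_sq (k : TorusSite 2 L) :
    ∑ j : Fin 2, fsumWeight L k j ≤ torusNorm L k ^ 2 / 2 := by
  have hsq : torusNorm L k ^ 2
      = (2 * Real.pi / (L : ℝ)) ^ 2 * ∑ i : Fin 2, (((min (k i).val (L - (k i).val) : ℕ) : ℝ)) ^ 2 := by
    unfold torusNorm
    rw [mul_pow, Real.sq_sqrt (Finset.sum_nonneg fun i _ => sq_nonneg _)]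
  rw [hsq, Finset.mul_sum, Finset.sum_div]
  refine Finset.sum_le_sum fun j _ => ?_
  refine (fsumWeight_le_sq L k j).trans (le_of_eq ?_)
  ring

end FSumWeight

section Linear

/-- **RUNG IR2 — `S(k) ≤ C·|k|_T` FROM (K) + f-SUM (PROVED; memo ROTOR-THEORY-9 §136 (b), (l)).**
`(P·S(k))² = (Σᵢ|cᵢ|²)² ≤ m₁(k)·m₋₁(k)` (spectral Cauchy–Schwarz, tree `cs_spectral`) with
`m₁(k) = Σ_j (1 − cos(2πk_j/L))⟨−T_j⟩ ≤ (|k|_T²/2)(L²/2)` (lattice f-sum rule + `sum_fsumWeight_le_torusNorm_sq` +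
`⟨−T_j⟩ ≤ L²/2`) and `m₋₁(k) ≤ κ⁺L²` ((K)), and `P ≥ (ρ/2)L²` on the density window:
`S(k) ≤ (√κ⁺/ρ)·|k|_T` for the Perron amplitudes of both sectors `M_L`, `M_L − 1`, eventually in `L`, all `k ≠ 0`.
Pitaevskii–Stringari (1991); Stringari in Griffin–Snoke–Stringari (1995) pp. 72–76. [folklore] -/
theorem structureFactor_le_linear_of_susceptibility (Δ : ℝ) (M : ℕ → ℝ) (ρ : ℝ) (hρ : ρ ∈ Set.Ioo (0 : ℝ) 1)
    (hlim : Tendsto (fun L : ℕ => 1 / 2 + M L / (L : ℝ) ^ 2) atTop (nhds ρ))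
    (hF : LatticeFSumRule Δ) (hK : UniformSusceptibility Δ M) :
    ∃ C : ℝ, ∀ᶠ L : ℕ in atTop, ∀ [NeZero L],
      ∀ a : TensorIndex (TorusSite 2 L) 2 → ℝ, ∀ M' ∈ ({M L, M L - 1} : Set ℝ),
        IsPerronSectorGroundAmplitude L Δ M' a →
          ∀ k : TorusSite 2 L, k ≠ 0 →
            structureFactor L a ((L : ℝ) ^ 2 / 2 + M') k ≤ C * torusNorm L k := by
  obtain ⟨κ, hκ⟩ := hK
  have hρ0 : 0 < ρ := hρ.1
  have hκ' : 0 ≤ max κ 0 := le_max_right κ 0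
  refine ⟨Real.sqrt (max κ 0) / ρ, ?_⟩
  have hMlo : ∀ᶠ L : ℕ in atTop, ρ / 2 ≤ 1 / 2 + (M L - 1) / (L : ℝ) ^ 2 :=
    (tendsto_density_pred M ρ hlim).eventually (eventually_ge_nhds (by linarith))
  filter_upwards [hκ, hMlo, eventually_ge_atTop 3] with L hKL hlo h3
  intro _ a M' hM' ha k hk
  have hL0 : (0 : ℝ) < (L : ℝ) := by exact_mod_cast Nat.pos_of_ne_zero (NeZero.ne L)
  have hL2 : (0 : ℝ) < (L : ℝ) ^ 2 := by positivity
  have hM'ge : M L - 1 ≤ M' := by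
    simp only [Set.mem_insert_iff, Set.mem_singleton_iff] at hM'
    rcases hM' with h | h
    · rw [h]; linarith
    · rw [h]
  have hPlo : ρ / 2 * (L : ℝ) ^ 2 ≤ (L : ℝ) ^ 2 / 2 + M' := by
    have h := mul_le_mul_of_nonneg_right hlo hL2.le
    rw [add_mul, div_mul_cancel₀ _ hL2.ne'] at h
    linarith
  have hP0 : 0 < (L : ℝ) ^ 2 / 2 + M' := lt_of_lt_of_le (by positivity) hPlo
  obtain ⟨hzero, hm⟩ := hKL a M' hM' ha k hk
  have htn : 0 ≤ torusNorm L k := by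
    unfold torusNorm; positivity
  -- Parseval: X = P·S
  have hX : ∑ i, ‖densityAmp L Δ a k i‖ ^ 2
      = ((L : ℝ) ^ 2 / 2 + M') * structureFactor L a ((L : ℝ) ^ 2 / 2 + M') k := by
    unfold densityAmp
    rw [sum_norm_sq_eigen_dotProduct, normSq_densityMode_mulVec L a _ hP0.ne' k]
  -- m₁ = f-sum ≤ (|k|_T²/2)(L²/2)
  have hFL := hF L h3 M' a ha k
  have hdiv : ∀ i, currentSpecWeight L Δ a k i / excitation L Δ M' i
      = excitation L Δ M' i * ‖densityAmp L Δ a k i‖ ^ 2 := by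
    intro i
    rw [currentSpecWeight_eq_sq L Δ M' a ha k i]
    rcases eq_or_ne (excitation L Δ M' i) 0 with h0 | h0
    · simp [h0]
    · rw [div_eq_iff h0]
      ring
  have hm1 : ∑ i, excitation L Δ M' i * ‖densityAmp L Δ a k i‖ ^ 2
      ≤ torusNorm L k ^ 2 / 2 * ((L : ℝ) ^ 2 / 2) := by
    rw [show (∑ i, excitation L Δ M' i * ‖densityAmp L Δ a k i‖ ^ 2)
        = ∑ j : Fin 2, fsumWeight L k j * kineticExpect L a j from by
          rw [← hFL]; exact Finset.sum_congr rfl fun i _ => (hdiv i).symm]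
    calc ∑ j : Fin 2, fsumWeight L k j * kineticExpect L a j
        ≤ ∑ j : Fin 2, fsumWeight L k j * ((L : ℝ) ^ 2 / 2) :=
          Finset.sum_le_sum fun j _ =>
            mul_le_mul_of_nonneg_left (kineticExpect_le L ha j) (fsumWeight_nonneg L k j)
      _ = (∑ j : Fin 2, fsumWeight L k j) * ((L : ℝ) ^ 2 / 2) := by rw [Finset.sum_mul]
      _ ≤ torusNorm L k ^ 2 / 2 * ((L : ℝ) ^ 2 / 2) :=
          mul_le_mul_of_nonneg_right (sum_fsumWeight_le_torusNorm_sq L k) (by positivity)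
  -- m₋₁ ≤ κ⁺ L²
  have hm_1 : ∑ i, ‖densityAmp L Δ a k i‖ ^ 2 / excitation L Δ M' i ≤ max κ 0 * (L : ℝ) ^ 2 :=
    hm.trans (mul_le_mul_of_nonneg_right (le_max_left κ 0) hL2.le)
  -- Cauchy–Schwarz
  obtain ⟨hcs, hm1nn, hm_1nn⟩ := cs_spectral (fun i => ‖densityAmp L Δ a k i‖) (fun i => excitation L Δ M' i)
    (fun i hi => by rw [hzero i hi, norm_zero])
  have hX2 : (∑ i, ‖densityAmp L Δ a k i‖ ^ 2) ^ 2
      ≤ (torusNorm L k ^ 2 / 2 * ((L : ℝ) ^ 2 / 2)) * (max κ 0 * (L : ℝ) ^ 2) :=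
    hcs.trans (mul_le_mul hm1 hm_1 hm_1nn (by positivity))
  have hB2 : (torusNorm L k * Real.sqrt (max κ 0) * (L : ℝ) ^ 2 / 2) ^ 2
      = (torusNorm L k ^ 2 / 2 * ((L : ℝ) ^ 2 / 2)) * (max κ 0 * (L : ℝ) ^ 2) := by
    rw [div_pow, mul_pow, mul_pow, Real.sq_sqrt hκ']
    ring
  have hXB : ∑ i, ‖densityAmp L Δ a k i‖ ^ 2 ≤ torusNorm L k * Real.sqrt (max κ 0) * (L : ℝ) ^ 2 / 2 := by
    have h := Real.sqrt_le_sqrt (hX2.trans hB2.symm.le)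
    rwa [Real.sqrt_sq (Finset.sum_nonneg fun i _ => sq_nonneg _), Real.sqrt_sq (by positivity)] at h
  -- conclusion
  have h5 : torusNorm L k * Real.sqrt (max κ 0) * (L : ℝ) ^ 2 / 2
      ≤ ((L : ℝ) ^ 2 / 2 + M') * (Real.sqrt (max κ 0) / ρ * torusNorm L k) := by
    rw [show ((L : ℝ) ^ 2 / 2 + M') * (Real.sqrt (max κ 0) / ρ * torusNorm L k)
        = ((L : ℝ) ^ 2 / 2 + M') * (Real.sqrt (max κ 0) * torusNorm L k) / ρ by ring]
    rw [le_div_iff₀ hρ0]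
    have hst : 0 ≤ Real.sqrt (max κ 0) * torusNorm L k := by positivity
    nlinarith [mul_le_mul_of_nonneg_left hPlo hst]
  have h6 : ((L : ℝ) ^ 2 / 2 + M') * structureFactor L a ((L : ℝ) ^ 2 / 2 + M') k
      ≤ ((L : ℝ) ^ 2 / 2 + M') * (Real.sqrt (max κ 0) / ρ * torusNorm L k) := by
    rw [← hX]
    exact hXB.trans h5
  exact le_of_mul_le_mul_left h6 hP0

/-- **RUNG IR2 with the f-sum rule discharged** (tree theorem `latticeFSumRule_holds`): along `ρ_L → ρ ∈ (0,1)`,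
(K) `UniformSusceptibility Δ M` alone gives `∃ C, ∀ᶠ L, S(k) ≤ C·|k|_T` (both sectors, all `k ≠ 0`). [folklore] -/
theorem structureFactor_le_linear_of_uniformSusceptibility (Δ : ℝ) (M : ℕ → ℝ) (ρ : ℝ)
    (hρ : ρ ∈ Set.Ioo (0 : ℝ) 1)
    (hlim : Tendsto (fun L : ℕ => 1 / 2 + M L / (L : ℝ) ^ 2) atTop (nhds ρ))
    (hK : UniformSusceptibility Δ M) :
    ∃ C : ℝ, ∀ᶠ L : ℕ in atTop, ∀ [NeZero L],
      ∀ a : TensorIndex (TorusSite 2 L) 2 → ℝ, ∀ M' ∈ ({M L, M L - 1} : Set ℝ),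
        IsPerronSectorGroundAmplitude L Δ M' a →
          ∀ k : TorusSite 2 L, k ≠ 0 →
            structureFactor L a ((L : ℝ) ^ 2 / 2 + M') k ≤ C * torusNorm L k :=
  structureFactor_le_linear_of_susceptibility Δ M ρ hρ hlim (latticeFSumRule_holds Δ) hK

end Linear

end Summit.HubbardSuperconductivity.HubbardSuperconductivity.Theorems.AnisotropyChord.Stiffness

/-! ## The abstract moment inequalities (HOME `PartT_Moments.lean` of the theory seat, verbatim up to the namespace)

Finite- or infinite-dimensional real inner-product space `E`; with `φ = (ρ_k − ⟨ρ_k⟩)ψ`, `T = H − E₀`: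
`m₀ = ‖φ‖²` (static structure factor), `m₁ = ⟪φ, Tφ⟫` (f-sum), and the static susceptibility defined VARIATIONALLY by
`χ ≥ sup_η (2⟪φ,η⟫ − ⟪η,Tη⟫)` (`= ⟪φ, T⁻¹φ⟫` when `T > 0` on the relevant subspace).  The in-tree spectral form is
`cs_spectral`; this variational form needs no positivity, invertibility or finite-dimension hypothesis. -/

namespace Summit.HubbardSuperconductivity.HubbardSuperconductivity.Theorems.AnisotropyChord.Stiffness.Moments

open scoped InnerProductSpace

variable {E : Type*} [NormedAddCommGroup E] [InnerProductSpace ℝ E]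

/-- **`m₀² ≤ m₁·m₋₁` (variational form).** If `χ` dominates the variational functional `2⟪φ,η⟫ − ⟪η,Tη⟫` for every
`η`, then `‖φ‖⁴ ≤ ⟪φ,Tφ⟫ · χ` (the three cases `m₁ < 0` / `= 0` / `> 0`; test vectors `η = l • φ`).
Theory seat `hubbard-h0-rotor-theory-1`, PartT_Moments.lean; Pitaevskii–Stringari (1991). [folklore] -/
theorem moment_ineq (T : E →ₗ[ℝ] E) (φ : E) (χ : ℝ)
    (hχ : ∀ η : E, 2 * ⟪φ, η⟫_ℝ - ⟪η, T η⟫_ℝ ≤ χ) :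
    ‖φ‖ ^ 4 ≤ ⟪φ, T φ⟫_ℝ * χ := by
  set m₀ : ℝ := ‖φ‖ ^ 2 with hm₀
  set m₁ : ℝ := ⟪φ, T φ⟫_ℝ with hm₁
  have hφφ : ⟪φ, φ⟫_ℝ = m₀ := real_inner_self_eq_norm_sq φ
  -- test vectors η = l • φ
  have htest : ∀ l : ℝ, 2 * l * m₀ - l ^ 2 * m₁ ≤ χ := by
    intro l
    have h := hχ (l • φ)
    rw [real_inner_smul_right, map_smul, real_inner_smul_left, real_inner_smul_right, hφφ] at h
    nlinarith [h]
  have hm₀nn : 0 ≤ m₀ := by positivity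
  have hχ0 : 0 ≤ χ := by have := htest 0; linarith
  rcases lt_trichotomy m₁ 0 with hneg | hzero | hpos
  · -- m₁ < 0: the functional is unbounded above
    exfalso
    have h := htest (Real.sqrt ((χ + 1) / (-m₁)))
    have hs : Real.sqrt ((χ + 1) / (-m₁)) ^ 2 = (χ + 1) / (-m₁) :=
      Real.sq_sqrt (div_nonneg (by linarith) (by linarith))
    have hl : 0 ≤ Real.sqrt ((χ + 1) / (-m₁)) := Real.sqrt_nonneg _
    rw [hs] at h
    have hm1 : m₁ ≠ 0 := hneg.ne
    have : (χ + 1) / -m₁ * m₁ = -(χ + 1) := by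
      rw [div_neg, neg_mul, div_mul_cancel₀ _ hm1]
    nlinarith [mul_nonneg hl hm₀nn]
  · -- m₁ = 0: 2 l m₀ ≤ χ for all l ⇒ m₀ = 0
    have hm : m₀ = 0 := by
      by_contra hne
      have hpos' : 0 < m₀ := lt_of_le_of_ne hm₀nn (Ne.symm hne)
      have h := htest ((χ + 1) / (2 * m₀))
      rw [hzero, mul_zero, sub_zero] at h
      have : 2 * ((χ + 1) / (2 * m₀)) * m₀ = χ + 1 := by field_simp
      linarith
    have : ‖φ‖ ^ 4 = m₀ ^ 2 := by rw [hm₀]; ring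
    rw [this, hm, hzero]; simp
  · -- m₁ > 0: optimise l = m₀/m₁
    have h := htest (m₀ / m₁)
    have h' : 2 * (m₀ / m₁) * m₀ - (m₀ / m₁) ^ 2 * m₁ = m₀ ^ 2 / m₁ := by field_simp; ring
    rw [h'] at h
    have : ‖φ‖ ^ 4 = m₀ ^ 2 := by rw [hm₀]; ring
    rw [this]
    rw [mul_comm]; exact (div_le_iff₀ hpos).mp h

/-- **f-sum / double-commutator form of `m₁`.** For symmetric `A`, `H` and an eigenvector `Hψ = E₀•ψ`:
`⟪Aψ, H(Aψ)⟫ − E₀‖Aψ‖² = ⟪ψ, A(H(Aψ))⟫ − ⟪ψ, H(A(Aψ))⟫` (both terms on the right are halves of `−⟨ψ,[A,[A,H]]ψ⟩`).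
Theory seat PartT_Moments.lean. [folklore] -/
theorem fsum_double_commutator (A H : E →ₗ[ℝ] E) (ψ : E) (E₀ : ℝ)
    (hA : ∀ x y : E, ⟪A x, y⟫_ℝ = ⟪x, A y⟫_ℝ) (hH : ∀ x y : E, ⟪H x, y⟫_ℝ = ⟪x, H y⟫_ℝ)
    (hψ : H ψ = E₀ • ψ) :
    ⟪A ψ, H (A ψ)⟫_ℝ - E₀ * ‖A ψ‖ ^ 2 = ⟪ψ, A (H (A ψ))⟫_ℝ - ⟪ψ, H (A (A ψ))⟫_ℝ := by
  have h1 : ⟪A ψ, H (A ψ)⟫_ℝ = ⟪ψ, A (H (A ψ))⟫_ℝ := hA ψ (H (A ψ))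
  have h2 : ⟪ψ, H (A (A ψ))⟫_ℝ = E₀ * ‖A ψ‖ ^ 2 := by
    rw [← hH, hψ, real_inner_smul_left, ← hA, real_inner_self_eq_norm_sq]
  rw [h1, h2]

/-- The symmetric double-commutator identity:
`2(⟪Aψ,H(Aψ)⟫ − E₀‖Aψ‖²) = 2⟪ψ,A(H(Aψ))⟫ − ⟪ψ,A(A(Hψ))⟫ − ⟪ψ,H(A(Aψ))⟫ = −⟨[A,[A,H]]⟩`.
Theory seat PartT_Moments.lean. [folklore] -/
theorem fsum_double_commutator' (A H : E →ₗ[ℝ] E) (ψ : E) (E₀ : ℝ)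
    (hA : ∀ x y : E, ⟪A x, y⟫_ℝ = ⟪x, A y⟫_ℝ) (hH : ∀ x y : E, ⟪H x, y⟫_ℝ = ⟪x, H y⟫_ℝ)
    (hψ : H ψ = E₀ • ψ) :
    2 * (⟪A ψ, H (A ψ)⟫_ℝ - E₀ * ‖A ψ‖ ^ 2)
      = 2 * ⟪ψ, A (H (A ψ))⟫_ℝ - ⟪ψ, A (A (H ψ))⟫_ℝ - ⟪ψ, H (A (A ψ))⟫_ℝ := by
  have h := fsum_double_commutator A H ψ E₀ hA hH hψ
  have h3 : ⟪ψ, A (A (H ψ))⟫_ℝ = E₀ * ‖A ψ‖ ^ 2 := by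
    rw [hψ, map_smul, map_smul, real_inner_smul_right, ← hA, real_inner_self_eq_norm_sq]
  have h2 : ⟪ψ, H (A (A ψ))⟫_ℝ = E₀ * ‖A ψ‖ ^ 2 := by
    rw [← hH, hψ, real_inner_smul_left, ← hA, real_inner_self_eq_norm_sq]
  linarith

/-- **IR2 core (structure factor ≤ √(f-sum × susceptibility)), root-free form `‖φ‖⁴ ≤ f·χ`** for a fluctuation vector
`φ`, `T = H − E₀`, an f-sum bound `⟪φ,Tφ⟫ ≤ f` and a variational susceptibility `χ`.
Theory seat PartT_Moments.lean; Pitaevskii–Stringari (1991). [folklore] -/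
theorem structureFactor_sq_le (T : E →ₗ[ℝ] E) (φ : E) (f χ : ℝ) (hf : ⟪φ, T φ⟫_ℝ ≤ f)
    (hχ : ∀ η : E, 2 * ⟪φ, η⟫_ℝ - ⟪η, T η⟫_ℝ ≤ χ) :
    ‖φ‖ ^ 4 ≤ f * χ := by
  have h := moment_ineq T φ χ hχ
  have hχ0 : 0 ≤ χ := by have := hχ 0; simp at this; linarith
  exact h.trans (mul_le_mul_of_nonneg_right hf hχ0)

end Summit.HubbardSuperconductivity.HubbardSuperconductivity.Theorems.AnisotropyChord.Stiffness.Moments
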